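import Mathlib
import HarnessLib

/-!
# The pre-Bloch group `P(F)` of a field and its unique divisibility (Suslin; Dupont–Sah)

The pre-Bloch group (scissors-congruence group of ideal hyperbolic tetrahedra) of a field `F`:
`P(F) = ℤ⟨F ∖ {0,1}⟩ / (five-term relations)`, with the five-term relation in the form of
Neumann, *Hilbert's 3rd problem and invariants of 3-manifolds*, Geom. Topol. Monogr. 1 (1998),
eq. (2.3):
`[x] - [y] + [y/x] - [(1 - x⁻¹)/(1 - y⁻¹)] + [(1 - x)/(1 - y)] = 0` (`x ≠ y` in `F ∖ {0,1}`),
which is the definition of `P(ℂ)` there and, "defined analogously", of `P(k)` for any field `k`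
(§2.1) [Neumann1998]; and the named fact that `P(F)` is UNIQUELY DIVISIBLE (a `ℚ`-vector space)
for every algebraically closed field `F` of characteristic `0` — Dupont, *Scissors congruences,
group homology and characteristic classes* (2001), Thm. 8.16 ("For `F` algebraically closed of
characteristic zero `P_F` is uniquely divisible", after Suslin, *`K₃` of a field and the Bloch
group*, 1991) [Dupont2001, Suslin1991]; divisibility alone is Dupont–Sah, *Scissors congruences
II* (1982), §5 [DupontSah1982]; for `F = ℂ` this is Neumann's Thm. 2.10 [Neumann1998].

## Contents

* `PreBloch.Gen F = F ∖ {0, 1}`; `fiveTermRelator`, `fiveTermRelators`, `PreBloch F` (a real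
  quotient of `FreeAbelianGroup`, with its `AddCommGroup` structure), `PreBloch.mk`;
* `IsUniquelyDivisible A` (multiplication by every `n ≥ 1` is bijective) [folklore];
* the fact `Suslin1991_preBloch_isUniquelyDivisible` and proved consequences: the case `F = ℂ`
  (Neumann's Thm. 2.10), the case `ℚ̄ = AlgebraicClosure ℚ`, and the torsion statement in the free abelian group
  (`n • ξ ∈ ⟨five-term⟩ → ξ ∈ ⟨five-term⟩`) used by route `KontsevichZagierPeriods/HyperbolicBloch`.

## Faithfulness notes

* Presentations. Dupont (8.13) and Dupont–Sah (5.3) write the five-term relation for the other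
  cross-ratio convention: `{z₁} - {z₂} + {z₂/z₁} - {(1-z₂)/(1-z₁)} + {(1-z₂⁻¹)/(1-z₁⁻¹)} = 0`. The
  bijection of generators `[z] ↦ -{z⁻¹}` carries Neumann's relator at `(x, y)` to MINUS Dupont's
  relator at `(x⁻¹, y⁻¹)` and conversely, so the two presentations define canonically isomorphic
  groups over every field; Thm. 8.16 therefore applies verbatim to `PreBloch F` below.
* Universe: the fact quantifies over fields in `Type` (enough for `ℂ`, its subfields and
  `AlgebraicClosure ℚ`).
* Nothing here about the Bloch group `B(F) = ker([z] ↦ z ∧ (1 - z))`, the Bloch–Wigner sequence, or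
  ranks ("infinite rank" in Thm. 2.10 is not transcribed).

## References

* W. D. Neumann, Geom. Topol. Monogr. 1 (1998) 383–411, arXiv:math/9712226: eq. (2.3), §2.1,
  Thm. 2.10. [Neumann1998]
* J. L. Dupont, *Scissors congruences, group homology and characteristic classes*, Nankai Tracts in
  Math. 1, World Scientific 2001: (8.13), Thm. 8.16. [Dupont2001]
* A. A. Suslin, *`K₃` of a field and the Bloch group*, Proc. Steklov Inst. Math. 183 (1991).
  [Suslin1991]
* J. L. Dupont, C.-H. Sah, *Scissors congruences II*, J. Pure Appl. Algebra 25 (1982), §5.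
  [DupontSah1982]
-/

noncomputable section

namespace Literature.NumberTheory.Transcendental

/-! ### Unique divisibility -/

/-- An additive commutative group is UNIQUELY DIVISIBLE if multiplication by every positive integer
is a bijection, i.e. it carries a (unique) `ℚ`-vector space structure. [folklore] -/
def IsUniquelyDivisible (A : Type*) [AddCommGroup A] : Prop :=
  ∀ n : ℕ, 0 < n → Function.Bijective fun a : A => n • a

/-- In a uniquely divisible group, `n • a = 0` with `n ≥ 1` forces `a = 0` (no torsion). [folklore] -/
theorem IsUniquelyDivisible.eq_zero_of_nsmul_eq_zero {A : Type*} [AddCommGroup A]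
    (h : IsUniquelyDivisible A) {n : ℕ} (hn : 0 < n) {a : A} (ha : n • a = 0) : a = 0 :=
  (h n hn).1 (by simpa using ha)

/-- In a uniquely divisible group every element is divisible by every `n ≥ 1`. [folklore] -/
theorem IsUniquelyDivisible.exists_nsmul_eq {A : Type*} [AddCommGroup A]
    (h : IsUniquelyDivisible A) {n : ℕ} (hn : 0 < n) (a : A) : ∃ b : A, n • b = a :=
  (h n hn).2 a

/-! ### The pre-Bloch group -/

variable (F : Type*) [Field F]

/-- The generators of the pre-Bloch group: `F ∖ {0, 1}`. [cite: Neumann1998, eq. (2.3)] -/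
def PreBloch.Gen : Type _ := {z : F // z ≠ 0 ∧ z ≠ 1}

namespace PreBloch.Gen

variable {F}

/-- The underlying field element. [cite: Neumann1998, eq. (2.3)] -/
def val (z : Gen F) : F := z.1

/-- A generator is nonzero. [cite: Neumann1998, eq. (2.3)] -/
theorem val_ne_zero (z : Gen F) : z.val ≠ 0 := z.2.1

/-- A generator is not `1`. [cite: Neumann1998, eq. (2.3)] -/
theorem val_ne_one (z : Gen F) : z.val ≠ 1 := z.2.2

/-- Third term of the five-term relation: `y / x ∈ F ∖ {0,1}` for `x ≠ y`. [cite: Neumann1998, eq. (2.3)] -/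
def quot (x y : Gen F) (hxy : x.val ≠ y.val) : Gen F :=
  ⟨y.val / x.val, div_ne_zero y.val_ne_zero x.val_ne_zero,
    fun h => hxy ((div_eq_one_iff_eq x.val_ne_zero).1 h).symm⟩

/-- Fourth term: `(1 - x⁻¹) / (1 - y⁻¹) ∈ F ∖ {0,1}` for `x ≠ y`. [cite: Neumann1998, eq. (2.3)] -/
def quotInv (x y : Gen F) (hxy : x.val ≠ y.val) : Gen F :=
  ⟨(1 - x.val⁻¹) / (1 - y.val⁻¹), by
    refine div_ne_zero ?_ ?_
    · exact sub_ne_zero.2 (fun h => x.val_ne_one (inv_eq_one.1 h.symm))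
    · exact sub_ne_zero.2 (fun h => y.val_ne_one (inv_eq_one.1 h.symm)), by
    intro h
    have hy : (1 : F) - y.val⁻¹ ≠ 0 :=
      sub_ne_zero.2 (fun h => y.val_ne_one (inv_eq_one.1 h.symm))
    rw [div_eq_one_iff_eq hy, sub_right_inj, inv_inj] at h
    exact hxy h⟩

/-- Fifth term: `(1 - x) / (1 - y) ∈ F ∖ {0,1}` for `x ≠ y`. [cite: Neumann1998, eq. (2.3)] -/
def quotSub (x y : Gen F) (hxy : x.val ≠ y.val) : Gen F :=
  ⟨(1 - x.val) / (1 - y.val),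
    div_ne_zero (sub_ne_zero.2 (Ne.symm x.val_ne_one)) (sub_ne_zero.2 (Ne.symm y.val_ne_one)), by
    intro h
    rw [div_eq_one_iff_eq (sub_ne_zero.2 (Ne.symm y.val_ne_one)), sub_right_inj] at h
    exact hxy h⟩

/-- Value of the third term. [cite: Neumann1998, eq. (2.3)] -/
@[simp] theorem val_quot (x y : Gen F) (hxy : x.val ≠ y.val) : (quot x y hxy).val = y.val / x.val := rfl

/-- Value of the fourth term. [cite: Neumann1998, eq. (2.3)] -/
@[simp] theorem val_quotInv (x y : Gen F) (hxy : x.val ≠ y.val) :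
    (quotInv x y hxy).val = (1 - x.val⁻¹) / (1 - y.val⁻¹) := rfl

/-- Value of the fifth term. [cite: Neumann1998, eq. (2.3)] -/
@[simp] theorem val_quotSub (x y : Gen F) (hxy : x.val ≠ y.val) :
    (quotSub x y hxy).val = (1 - x.val) / (1 - y.val) := rfl

end PreBloch.Gen

open PreBloch in
/-- The five-term relator `[x] - [y] + [y/x] - [(1 - x⁻¹)/(1 - y⁻¹)] + [(1 - x)/(1 - y)]` in the free
abelian group on `F ∖ {0,1}`, for `x ≠ y` (Neumann, eq. (2.3); Dupont–Sah (5.3) up to the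
convention explained in the module docstring). [cite: Neumann1998, eq. (2.3)] -/
def fiveTermRelator (x y : Gen F) (hxy : x.val ≠ y.val) : FreeAbelianGroup (Gen F) :=
  FreeAbelianGroup.of x - FreeAbelianGroup.of y + FreeAbelianGroup.of (Gen.quot x y hxy) -
    FreeAbelianGroup.of (Gen.quotInv x y hxy) + FreeAbelianGroup.of (Gen.quotSub x y hxy)

/-- The set of all five-term relators. [cite: Neumann1998, eq. (2.3)] -/
def fiveTermRelators : Set (FreeAbelianGroup (PreBloch.Gen F)) :=
  {r | ∃ (x y : PreBloch.Gen F) (hxy : x.val ≠ y.val), r = fiveTermRelator F x y hxy}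

/-- The **pre-Bloch group** `P(F) = ℤ⟨F ∖ {0,1}⟩ / (five-term relations)` of a field `F`
(Neumann's `𝒫(ℂ)`, "defined analogously" for any field; Dupont–Sah's `P_F`, Dupont's `𝒫_F`).
[cite: Neumann1998, eq. (2.3) and §2.1] -/
def PreBloch : Type _ :=
  FreeAbelianGroup (PreBloch.Gen F) ⧸ AddSubgroup.closure (fiveTermRelators F)

/-- `P(F)` is an abelian group. [cite: Neumann1998, §2] -/
instance PreBloch.instAddCommGroup : AddCommGroup (PreBloch F) :=
  inferInstanceAs (AddCommGroup
    (FreeAbelianGroup (PreBloch.Gen F) ⧸ AddSubgroup.closure (fiveTermRelators F)))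

variable {F}

/-- The class `[z] ∈ P(F)` of `z ∈ F ∖ {0, 1}`. [cite: Neumann1998, eq. (2.3)] -/
def PreBloch.mk (z : F) (hz : z ≠ 0 ∧ z ≠ 1) : PreBloch F :=
  QuotientAddGroup.mk (FreeAbelianGroup.of (⟨z, hz⟩ : PreBloch.Gen F))

/-- The quotient map `ℤ⟨F ∖ {0,1}⟩ → P(F)`. [cite: Neumann1998, eq. (2.3)] -/
def PreBloch.proj : FreeAbelianGroup (PreBloch.Gen F) →+ PreBloch F :=
  QuotientAddGroup.mk' (AddSubgroup.closure (fiveTermRelators F))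

/-- The quotient map is surjective. [cite: Neumann1998, eq. (2.3)] -/
theorem PreBloch.proj_surjective : Function.Surjective (PreBloch.proj (F := F)) :=
  QuotientAddGroup.mk'_surjective _

/-- The kernel of the quotient map is the subgroup generated by the five-term relators.
[cite: Neumann1998, eq. (2.3)] -/
theorem PreBloch.proj_eq_zero_iff (ξ : FreeAbelianGroup (PreBloch.Gen F)) :
    PreBloch.proj ξ = 0 ↔ ξ ∈ AddSubgroup.closure (fiveTermRelators F) :=
  QuotientAddGroup.eq_zero_iff ξ

/-- **The five-term relation holds in `P(F)`**: for `x ≠ y` in `F ∖ {0,1}`,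
`[x] - [y] + [y/x] - [(1-x⁻¹)/(1-y⁻¹)] + [(1-x)/(1-y)] = 0`. [cite: Neumann1998, eq. (2.3)] -/
theorem PreBloch.five_term (x y : PreBloch.Gen F) (hxy : x.val ≠ y.val) :
    PreBloch.proj (fiveTermRelator F x y hxy) = 0 :=
  (PreBloch.proj_eq_zero_iff _).2 (AddSubgroup.subset_closure ⟨x, y, hxy, rfl⟩)

/-! ### The named fact and its consequences -/

/-- **Unique divisibility of the pre-Bloch group of an algebraically closed field of
characteristic zero** (Dupont 2001, Thm. 8.16: "For `F` algebraically closed of characteristic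
zero `𝒫_F` is uniquely divisible", after Suslin 1991; divisibility: Dupont–Sah 1982, §5; the case
`F = ℂ`: Neumann 1998, Thm. 2.10, "`𝒫(ℂ)` and its subgroup `ℬ(ℂ)` are uniquely divisible groups, so
they have the structure of `ℚ`-vector spaces"). For every algebraically closed field `F` of
characteristic `0`, multiplication by every `n ≥ 1` is a bijection of `P(F)`.
[cite: Dupont2001, Thm. 8.16] -/
def Suslin1991_preBloch_isUniquelyDivisible : Prop :=
  ∀ (F : Type) [Field F] [IsAlgClosed F] [CharZero F], IsUniquelyDivisible (PreBloch F)

/-- Neumann's Thm. 2.10 for `𝒫(ℂ)`: the pre-Bloch group of `ℂ` is uniquely divisible (from the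
fact). [cite: Neumann1998, Thm. 2.10] -/
theorem Suslin1991_preBloch_isUniquelyDivisible.complex (h : Suslin1991_preBloch_isUniquelyDivisible) :
    IsUniquelyDivisible (PreBloch ℂ) :=
  h ℂ

/-- The case of an algebraic closure `ℚ̄` of `ℚ` (Mathlib's `AlgebraicClosure ℚ`, algebraically
closed of characteristic `0`), the field of the route `HyperbolicBloch` (from the fact).
[cite: Dupont2001, Thm. 8.16] -/
theorem Suslin1991_preBloch_isUniquelyDivisible.algebraicClosureRat
    (h : Suslin1991_preBloch_isUniquelyDivisible) :
    IsUniquelyDivisible (PreBloch (AlgebraicClosure ℚ)) :=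
  h (AlgebraicClosure ℚ)

/-- **No torsion modulo five-term relations** (the form used by route `HyperbolicBloch`: `ℤ`-linear
consequences of the five-term relations coincide with `ℚ`-linear ones): for `F` algebraically closed
of characteristic `0`, if `n • ξ` (`n ≥ 1`) lies in the subgroup of `ℤ⟨F ∖ {0,1}⟩` generated by the
five-term relators, then so does `ξ` (from the fact). [cite: Dupont2001, Thm. 8.16] -/
theorem Suslin1991_preBloch_isUniquelyDivisible.mem_closure_of_nsmul_mem
    (h : Suslin1991_preBloch_isUniquelyDivisible) {F : Type} [Field F] [IsAlgClosed F] [CharZero F]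
    {n : ℕ} (hn : 0 < n) {ξ : FreeAbelianGroup (PreBloch.Gen F)}
    (hξ : n • ξ ∈ AddSubgroup.closure (fiveTermRelators F)) :
    ξ ∈ AddSubgroup.closure (fiveTermRelators F) := by
  rw [← PreBloch.proj_eq_zero_iff] at hξ ⊢
  rw [map_nsmul] at hξ
  exact (h F).eq_zero_of_nsmul_eq_zero hn hξ

end Literature.NumberTheory.Transcendental
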